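import Summits.AtomisticToContinuum.FouriersLaw.Theses.EmbeddedDrudeMourre
import Summits.AtomisticToContinuum.FouriersLaw.Theorems.EmbeddedDrudeMourreGreenKuboContinuationCanonicalSpectralMeasure
import Summits.AtomisticToContinuum.FouriersLaw.Theorems.EmbeddedDrudeMourreAbelOfSpectralDensity
import Summits.AtomisticToContinuum.FouriersLaw.Theorems.LatticeLandauDampingAbelGreenKuboOfWindow
import Summits.AtomisticToContinuum.FouriersLaw.Theorems.EmbeddedDrudeMourreGreenKuboContinuationOfFourierGreenKubo
import Summits.AtomisticToContinuum.FouriersLaw.Theorems.EmbeddedDrudeMourreGreenKuboContinuationStieltjesInversion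
import Summits.AtomisticToContinuum.FouriersLaw.Theorems.EmbeddedDrudeMourreGreenKuboContinuationAtomEqDrudeWeight
import Summits.AtomisticToContinuum.FouriersLaw.Theorems.EmbeddedDrudeMourreGreenKuboContinuationAbelFloorOfEinsteinHelfand
import HarnessLib

/-!
# Skeleton of line `SpectralTrichotomy` for the crux `EmbeddedDrudeMourre.GreenKuboContinuation`
# (item stmt-AtomisticToContinuum-12597) — lead c8 reshaping (2026-08-17) of the crux-strategist's line; rev 6: S1b/S2a/S3b LANDED
# rev 8 (lead c9, 2026-08-17, continuation): held as registered — S1a/S2b/S3a are the open cores of stmt-14011/14012/14014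

The strategist's registered skeleton (`Lines/SpectralTrichotomy.lean` rev 3) had three stubs, VERBATIM the
three spectral cruxes `WindowDecomposition` / `NoDrudeWeight` / `PositiveDensity` of route
`LatticeLandauDamping` (stmt-14011 / 14012 / 14014).  This reshaping goes ONE level down, along that route's
own registered birth skeletons (`Cruxes/WindowDecomposition/Lines/birth.lean`,
`Cruxes/NoDrudeWeight/Lines/birth.lean`, `Cruxes/PositiveDensity/Lines/birth.lean`), with two gains:

* the two FRAMEWORK stubs of those births (`stub_currentSpectralMeasure`, `stub_zeroWavenumberFramework`)
  are not needed here at all: for THIS crux only ONE admissible representation per temperature is required,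
  and the canonical one is LANDED — `MourreDissolution.symmetricFramework_of_clustering` fed with the proved
  `MourreDissolution.stub_gibbsClustering` gives the Buttà–Marchioro dynamics `D` and, at every `T > 0`,
  Doyon's zero-wavenumber datum `Z` with `Z.μ` a DLR state at `T`, momentum reversal and a strongly
  continuous Koopman group; `exists_even_spectralMeasure_of_zeroWavenumberData` (p121052) gives the finite
  even spectral measure `σ_T` with `C_T = ∫ cos(ωt) dσ_T`;
* of the six remaining stubs three are theorem-grade analysis (S1b, S2a, S3b below) and three are the
  open-problem cores, each isolated BY NAME and each byte-identical with a registered birth stub of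
  stmt-14011 / 14012 / 14014, so that one proof serves both routes.

Stubs (signatures verbatim from the LLD birth skeletons, except S2a which carries one extra hypothesis):

* S1a `stub_zeroFrequencyLAP`      — limiting absorption at frequency 0 (OPEN; ≡ WindowDecomposition birth stub 2).
* S1b `stub_stieltjesInversion`    — Stieltjes inversion under a uniform LAP (real analysis; ≡ birth stub 3).
* S2a `stub_atomEqDrudeWeightOfContinuous` — atom at 0 = Drude weight `‖ℙψ‖²` for a strongly continuous Koopman
  group (Wiener + von Neumann; = NoDrudeWeight birth stub 2 plus the strong-continuity hypothesis, which the
  canonical datum supplies).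
* S2b `stub_conservedClassesEven`  — no odd conserved `ℋ₀`-class (OPEN; ≡ NoDrudeWeight birth stub 3).
* S3a `stub_einsteinHelfandFloor`  — diffusive floor of the Einstein–Helfand functional (OPEN; ≡ PositiveDensity birth stub 1).
* S3b `stub_abelFloorOfEinsteinHelfand` — Abelian step `Dc − Kν ≤ ∫e^{−νt}C` (real analysis; ≡ birth stub 2).

Composition `GreenKuboContinuation_of` (sorry-free outside the stubs): canonical `(D, Z, σ)` (landed) →
LAP + Stieltjes give a window `(−δ, δ)` with `σ|_{ω≠0} = g dω` there, `g` continuous `≥ 0` → the atom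
`σ{0}` is the Drude weight of `[J]` (S2a), killed by parity since every conserved class is even (S2b) and
`Θ[J] = −[J]` → `σ|_{(−δ,δ)} = g dω` → Einstein–Helfand floor (S3a) + Abelian step (S3b) + the PROVED
Poisson-kernel lemma `AbelOfSpectralDensity` (stmt-12598) give `0 < Dc ≤ π g(0)` and the Abel limit
`T⁻²∫e^{−νt}C_T → T⁻² π g(0) > 0` at EVERY `T > 0`; `greenKuboContinuation_of_abelWitnessAllT` (p115442)
discards the corner hypothesis.
-/

noncomputable section

namespace Summit.AtomisticToContinuum.FouriersLaw.Theorems.GreenKuboContinuation.SpectralTrichotomy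

open Filter Topology MeasureTheory Set
open scoped InnerProductSpace ENNReal
open Literature.MathematicalPhysics.KineticTheory.HeatConduction

/-! ## S1 — low-frequency window (≡ stmt-14011, split along its birth skeleton) -/

/-- **S1a `stub_zeroFrequencyLAP`** (≡ `Cruxes.WindowDecomposition.Birth.stub_zeroFrequencyLAP`, verbatim;
OPEN, the load-bearing stub of the whole line). Limiting absorption at frequency zero, operator-free: for
every admissible `(μ_T, D)` and every finite symmetric `σ` with `C_T = ∫ cos(ωt) dσ`, the Poisson
smoothings of `σ` with its atom at `0` removed converge uniformly on some closed window `[−δ, δ]`,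
`δ > 0`, as `ε ↓ 0`. [difficulty: open-problem] -/
theorem stub_zeroFrequencyLAP :
    ∀ ω₂ lam β γ : ℝ, 0 < ω₂ → 0 < lam → 0 < β → 0 < γ → ∀ T : ℝ, 0 < T →
      ∀ (μT : Measure ChainConfig) (D : InfiniteChainDynamics (pinnedChain ω₂ lam β γ)),
        (pinnedChain ω₂ lam β γ).IsChainGibbsMeasure T μT →
        (∀ x : ℤ, MeasurePreserving (fun σ : ChainConfig => fun i : ℤ => σ (i + x)) μT μT) →
        D.PreservesMeasure μT → (∀ t : ℝ, D.HasAbsConvergentCorrelation μT t) →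
        ∀ σ : Measure ℝ, IsFiniteMeasure σ → σ.map (fun ω : ℝ => -ω) = σ →
          (∀ t : ℝ, D.currentCorrelation μT t =
            MeasureTheory.integral σ (fun ω : ℝ => Real.cos (ω * t))) →
          ∃ (δ : ℝ) (g : ℝ → ℝ), 0 < δ ∧
            TendstoUniformlyOn
              (fun ε ω : ℝ => Real.pi⁻¹ *
                MeasureTheory.integral (σ.restrict {0}ᶜ) (fun ω' : ℝ => ε / ((ω' - ω) ^ 2 + ε ^ 2)))
              g (nhdsWithin (0 : ℝ) (Set.Ioi 0)) (Set.Icc (-δ) δ) := by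
  sorry

-- `stub_stieltjesInversion`: LANDED (p148690, Theorems/EmbeddedDrudeMourreGreenKuboContinuationStieltjesInversion.lean) — provided by the import, same fully-qualified name.

/-! ## S2 — no Drude weight (≡ stmt-14012, split along its birth skeleton; framework stub not needed) -/

-- `stub_atomEqDrudeWeightOfContinuous`: LANDED (p149655, Theorems/EmbeddedDrudeMourreGreenKuboContinuationAtomEqDrudeWeight.lean) — provided by the import, same fully-qualified name.

/-- **S2b `stub_conservedClassesEven`** (≡ `Cruxes.NoDrudeWeight.Birth.stub_conservedClassesEven`, verbatim;
OPEN — "no hidden odd charge"). For `pinnedChain ω₂ lam β γ` (all `> 0`), `T > 0`, every dynamics `D`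
and every zero-wavenumber datum `Z` whose state is a DLR Gibbs state at `T` and which has momentum-reversal
symmetry `Θ`: `Θ ψ = ψ` for every `ψ` in the conserved space `𝒬₀` (time reversal acts trivially on the
hydrodynamic sector; false at the harmonic point, so any proof uses `lam, β > 0`). [difficulty: open-problem] -/
theorem stub_conservedClassesEven :
    ∀ ω₂ lam β γ : ℝ, 0 < ω₂ → 0 < lam → 0 < β → 0 < γ → ∀ T : ℝ, 0 < T →
    ∀ (D : Literature.MathematicalPhysics.KineticTheory.HeatConduction.InfiniteChainDynamics
        (Literature.MathematicalPhysics.KineticTheory.HeatConduction.pinnedChain ω₂ lam β γ))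
      (Z : Literature.MathematicalPhysics.KineticTheory.HeatConduction.ZeroWavenumberData
        (Literature.MathematicalPhysics.KineticTheory.HeatConduction.pinnedChain ω₂ lam β γ) D),
      (Literature.MathematicalPhysics.KineticTheory.HeatConduction.pinnedChain ω₂ lam β γ).IsChainGibbsMeasure T Z.μ →
      ∀ (h : Z.HasMomentumReversal)
        (ψ : Literature.MathematicalPhysics.KineticTheory.HeatConduction.ZeroWavenumberSpace Z),
        ψ ∈ Z.toFluctuationDynamics.conservedSpace → Z.reversal h ψ = ψ := by
  sorry

/-! ## S3 — not an insulator (≡ stmt-14014, split along its birth skeleton) -/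

/-- **S3a `stub_einsteinHelfandFloor`** (≡ `Cruxes.PositiveDensity.Birth.stub_einsteinHelfandFloor`, verbatim;
OPEN). For the pinned anharmonic chain at `T > 0`, every shift-invariant Gibbs state, every preserving
infinite-volume dynamics with absolutely convergent current correlations and every finite spectral measure
`σ` of `C_T`, the Einstein–Helfand functional `Φ_T(t) = ∫₀ᵗ (t − s) C_T(s) ds` grows at least linearly:
`Dc·t − K ≤ Φ_T(t)` for all `t ≥ 0`, some `Dc > 0` (allows a Drude atom; false exactly for an
insulator). [difficulty: open-problem] -/
theorem stub_einsteinHelfandFloor :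
    ∀ ω₂ lam β γ : ℝ, 0 < ω₂ → 0 < lam → 0 < β → 0 < γ → ∀ T : ℝ, 0 < T →
    ∀ (μT : MeasureTheory.Measure Literature.MathematicalPhysics.KineticTheory.HeatConduction.ChainConfig)
      (D : Literature.MathematicalPhysics.KineticTheory.HeatConduction.InfiniteChainDynamics
        (Literature.MathematicalPhysics.KineticTheory.HeatConduction.pinnedChain ω₂ lam β γ)),
      (Literature.MathematicalPhysics.KineticTheory.HeatConduction.pinnedChain ω₂ lam β γ).IsChainGibbsMeasure T μT →
      (∀ x : ℤ, MeasureTheory.MeasurePreserving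
        (fun σ : Literature.MathematicalPhysics.KineticTheory.HeatConduction.ChainConfig => fun i : ℤ => σ (i + x)) μT μT) →
      D.PreservesMeasure μT → (∀ t : ℝ, D.HasAbsConvergentCorrelation μT t) →
    ∀ σ : MeasureTheory.Measure ℝ, MeasureTheory.IsFiniteMeasure σ →
      (∀ t : ℝ, D.currentCorrelation μT t = MeasureTheory.integral σ (fun ω : ℝ => Real.cos (ω * t))) →
    ∃ Dc K : ℝ, 0 < Dc ∧ ∀ t : ℝ, 0 ≤ t →
      Dc * t - K ≤ intervalIntegral (fun s : ℝ => (t - s) * D.currentCorrelation μT s) 0 t MeasureTheory.volume := by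
  sorry

-- `stub_abelFloorOfEinsteinHelfand`: LANDED (p150850, Theorems/EmbeddedDrudeMourreGreenKuboContinuationAbelFloorOfEinsteinHelfand.lean) — provided by the import, same fully-qualified name.

/-! ## Landed framework: the canonical representation at every temperature -/

/-- **The canonical representation (landed).** For `pinnedChain ω₂ lam β γ` (all `> 0`) and every
`T > 0`: the Buttà–Marchioro dynamics `D`, Doyon's zero-wavenumber datum `Z` of `(pinnedChain, D)` with
`Z.μ` a DLR Gibbs state at `T`, momentum-reversal symmetry and a strongly continuous Koopman group, and
a finite EVEN measure `σ` with `C_T(t) = D.currentCorrelation Z.μ t = ∫ cos(ωt) dσ(ω)` — assembled from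
`MourreDissolution.symmetricFramework_of_clustering`, the proved `MourreDissolution.stub_gibbsClustering`
and `exists_even_spectralMeasure_of_zeroWavenumberData` (p121052). [folklore] -/
theorem exists_canonical_representation {ω₂ lam β γ : ℝ} (hω : 0 < ω₂) (hl : 0 < lam) (hβ : 0 < β)
    (hγ : 0 < γ) {T : ℝ} (hT : 0 < T) :
    ∃ (D : InfiniteChainDynamics (pinnedChain ω₂ lam β γ)) (Z : ZeroWavenumberData (pinnedChain ω₂ lam β γ) D)
      (σ : Measure ℝ), (pinnedChain ω₂ lam β γ).IsChainGibbsMeasure T Z.μ ∧ Z.HasMomentumReversal ∧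
      (∀ ψ : ZeroWavenumberSpace Z, Continuous fun t : ℝ => Z.koopman t ψ) ∧
      IsFiniteMeasure σ ∧ σ.map (fun ω : ℝ => -ω) = σ ∧
      ∀ t : ℝ, D.currentCorrelation Z.μ t = ∫ ω, Real.cos (ω * t) ∂σ := by
  obtain ⟨D, -, hfam⟩ :=
    Summit.AtomisticToContinuum.FouriersLaw.Theorems.MourreDissolution.symmetricFramework_of_clustering
      Summit.AtomisticToContinuum.FouriersLaw.Theorems.MourreDissolution.stub_gibbsClustering
      ω₂ lam β γ hω hl hβ hγ
  obtain ⟨Z, hG, -, hRev, -, -, -, hsc⟩ := hfam T hT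
  obtain ⟨σ, hσ, hσeven, hcos⟩ :=
    BandLimitedKrylov.exists_even_spectralMeasure_of_zeroWavenumberData Z hRev hsc
  exact ⟨D, Z, σ, hG, hRev, hsc, hσ, hσeven, hcos⟩

/-- **No Drude weight for a reversal-symmetric datum, from S2a + S2b.** If every conserved class of `Z` is
`Θ`-even then the atom at `0` of any finite spectral measure `σ` of `C_T = ⟪[J], U_t[J]⟫₀` vanishes:
`Θ` is isometric with `Θ[J] = −[J]`, so `[J] ⊥ 𝒬₀`, the Drude weight `‖ℙ[J]‖²` is `0`, and S2a reads it
as `σ{0}` (the argument of `Cruxes.NoDrudeWeight.Birth.NoDrudeWeight_of`). [folklore] -/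
theorem measure_zero_eq_zero_of_stubs
    (h2 : ∀ (P : OscillatorChain) (D : InfiniteChainDynamics P) (Z : ZeroWavenumberData P D),
      (∀ φ : ZeroWavenumberSpace Z, Continuous fun t : ℝ => Z.koopman t φ) →
      ∀ (ψ : ZeroWavenumberSpace Z) (σ : Measure ℝ), IsFiniteMeasure σ →
      (∀ t : ℝ, ⟪ψ, Z.koopman t ψ⟫_ℝ = MeasureTheory.integral σ (fun ω : ℝ => Real.cos (ω * t))) →
      (σ {0}).toReal = Z.toFluctuationDynamics.drudeWeight ψ)
    {ω₂ lam β γ : ℝ} {D : InfiniteChainDynamics (pinnedChain ω₂ lam β γ)}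
    (Z : ZeroWavenumberData (pinnedChain ω₂ lam β γ) D) (hRev : Z.HasMomentumReversal)
    (hsc : ∀ φ : ZeroWavenumberSpace Z, Continuous fun t : ℝ => Z.koopman t φ)
    (heven : ∀ ψ : ZeroWavenumberSpace Z, ψ ∈ Z.toFluctuationDynamics.conservedSpace → Z.reversal hRev ψ = ψ)
    (σ : Measure ℝ) [IsFiniteMeasure σ]
    (hC : ∀ t : ℝ, D.currentCorrelation Z.μ t = ∫ ω, Real.cos (ω * t) ∂σ) :
    σ {0} = 0 := by
  -- `⟪[J], U_t [J]⟫₀ = C_T(t) = ∫ cos(ωt) dσ(ω)`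
  have hrep : ∀ t : ℝ, ⟪Z.currentClass, Z.koopman t Z.currentClass⟫_ℝ =
      MeasureTheory.integral σ (fun ω : ℝ => Real.cos (ω * t)) :=
    fun t => (Z.inner_currentClass_koopman_eq_currentCorrelation' hRev t).trans (hC t)
  -- S2a: the atom is the Drude weight of the current class
  have hatom : (σ {0}).toReal = Z.toFluctuationDynamics.drudeWeight Z.currentClass :=
    h2 _ D Z hsc Z.currentClass σ inferInstance hrep
  -- S2b + parity: `[J] ⊥ 𝒬₀`
  have hDW : Z.toFluctuationDynamics.drudeWeight Z.currentClass = 0 := by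
    rw [Literature.MathematicalPhysics.KineticTheory.FluctuationDynamics.drudeWeight_eq_zero_iff,
      Submodule.mem_orthogonal]
    intro u hu
    have hfix : Z.reversal hRev u = u := heven u hu
    have key : ⟪u, Z.currentClass⟫_ℝ = -⟪u, Z.currentClass⟫_ℝ := by
      calc ⟪u, Z.currentClass⟫_ℝ
          = ⟪Z.reversal hRev u, Z.reversal hRev Z.currentClass⟫_ℝ :=
            (Z.inner_reversal_reversal hRev u Z.currentClass).symm
        _ = ⟪u, -Z.currentClass⟫_ℝ := by
            rw [hfix, Z.reversal_currentClass hRev]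
            try rfl
        _ = -⟪u, Z.currentClass⟫_ℝ := inner_neg_right _ _
    linarith
  rw [hDW] at hatom
  rcases (ENNReal.toReal_eq_zero_iff _).1 hatom with h0 | htop
  · exact h0
  · exact absurd htop (measure_ne_top σ _)

/-! ## Composition -/

/-- **All-temperature Abelian Green–Kubo witnesses from the six stubs** (hypothesis form, sorry-free).
At `(ω₂, lam, β, γ, T)`: canonical `(D, Z, σ)` (landed); `μ := Z.μ` is shift invariant
(`Z.measurePreserving_shift`), preserved, with absolutely convergent correlations (mean current `0` by
reversal); S1a + S1b on `σ|_{ω≠0}` give the window density `g`; S2a + S2b kill the atom, so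
`σ|_{(−δ,δ)} = g dω`; S3a + S3b give `Dc − Kν ≤ ∫e^{−νt}C_T`, the proved Poisson-kernel lemma
(`latticeLandauDamping_abelOfSpectralDensity_proof`, stmt-12598) gives `∫e^{−νt}C_T → π g 0`, hence
`0 < Dc ≤ π g 0` and `κ := (T²)⁻¹ π g 0 > 0` is the Abel limit. [folklore] -/
theorem abelWitnessAllT_of_stubs
    (h1a : ∀ ω₂ lam β γ : ℝ, 0 < ω₂ → 0 < lam → 0 < β → 0 < γ → ∀ T : ℝ, 0 < T →
      ∀ (μT : Measure ChainConfig) (D : InfiniteChainDynamics (pinnedChain ω₂ lam β γ)),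
        (pinnedChain ω₂ lam β γ).IsChainGibbsMeasure T μT →
        (∀ x : ℤ, MeasurePreserving (fun σ : ChainConfig => fun i : ℤ => σ (i + x)) μT μT) →
        D.PreservesMeasure μT → (∀ t : ℝ, D.HasAbsConvergentCorrelation μT t) →
        ∀ σ : Measure ℝ, IsFiniteMeasure σ → σ.map (fun ω : ℝ => -ω) = σ →
          (∀ t : ℝ, D.currentCorrelation μT t =
            MeasureTheory.integral σ (fun ω : ℝ => Real.cos (ω * t))) →
          ∃ (δ : ℝ) (g : ℝ → ℝ), 0 < δ ∧
            TendstoUniformlyOn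
              (fun ε ω : ℝ => Real.pi⁻¹ *
                MeasureTheory.integral (σ.restrict {0}ᶜ) (fun ω' : ℝ => ε / ((ω' - ω) ^ 2 + ε ^ 2)))
              g (nhdsWithin (0 : ℝ) (Set.Ioi 0)) (Set.Icc (-δ) δ))
    (h1b : ∀ (ρ : Measure ℝ), IsFiniteMeasure ρ → ∀ (δ : ℝ) (g : ℝ → ℝ),
      TendstoUniformlyOn
        (fun ε ω : ℝ => Real.pi⁻¹ *
          MeasureTheory.integral ρ (fun ω' : ℝ => ε / ((ω' - ω) ^ 2 + ε ^ 2)))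
        g (nhdsWithin (0 : ℝ) (Set.Ioi 0)) (Set.Icc (-δ) δ) →
      ContinuousOn g (Set.Ioo (-δ) δ) ∧ (∀ ω ∈ Set.Ioo (-δ) δ, 0 ≤ g ω) ∧
        ρ.restrict (Set.Ioo (-δ) δ) =
          (volume.restrict (Set.Ioo (-δ) δ)).withDensity (fun ω => ENNReal.ofReal (g ω)))
    (h2a : ∀ (P : OscillatorChain) (D : InfiniteChainDynamics P) (Z : ZeroWavenumberData P D),
      (∀ φ : ZeroWavenumberSpace Z, Continuous fun t : ℝ => Z.koopman t φ) →
      ∀ (ψ : ZeroWavenumberSpace Z) (σ : Measure ℝ), IsFiniteMeasure σ →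
      (∀ t : ℝ, ⟪ψ, Z.koopman t ψ⟫_ℝ = MeasureTheory.integral σ (fun ω : ℝ => Real.cos (ω * t))) →
      (σ {0}).toReal = Z.toFluctuationDynamics.drudeWeight ψ)
    (h2b : ∀ ω₂ lam β γ : ℝ, 0 < ω₂ → 0 < lam → 0 < β → 0 < γ → ∀ T : ℝ, 0 < T →
      ∀ (D : InfiniteChainDynamics (pinnedChain ω₂ lam β γ)) (Z : ZeroWavenumberData (pinnedChain ω₂ lam β γ) D),
        (pinnedChain ω₂ lam β γ).IsChainGibbsMeasure T Z.μ →
        ∀ (h : Z.HasMomentumReversal) (ψ : ZeroWavenumberSpace Z),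
          ψ ∈ Z.toFluctuationDynamics.conservedSpace → Z.reversal h ψ = ψ)
    (h3a : ∀ ω₂ lam β γ : ℝ, 0 < ω₂ → 0 < lam → 0 < β → 0 < γ → ∀ T : ℝ, 0 < T →
      ∀ (μT : Measure ChainConfig) (D : InfiniteChainDynamics (pinnedChain ω₂ lam β γ)),
        (pinnedChain ω₂ lam β γ).IsChainGibbsMeasure T μT →
        (∀ x : ℤ, MeasurePreserving (fun σ : ChainConfig => fun i : ℤ => σ (i + x)) μT μT) →
        D.PreservesMeasure μT → (∀ t : ℝ, D.HasAbsConvergentCorrelation μT t) →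
      ∀ σ : Measure ℝ, IsFiniteMeasure σ →
        (∀ t : ℝ, D.currentCorrelation μT t = MeasureTheory.integral σ (fun ω : ℝ => Real.cos (ω * t))) →
      ∃ Dc K : ℝ, 0 < Dc ∧ ∀ t : ℝ, 0 ≤ t →
        Dc * t - K ≤ intervalIntegral (fun s : ℝ => (t - s) * D.currentCorrelation μT s) 0 t volume)
    (h3b : ∀ (σ : Measure ℝ) (C : ℝ → ℝ) (Dc K : ℝ), IsFiniteMeasure σ →
      (∀ t : ℝ, C t = MeasureTheory.integral σ (fun ω : ℝ => Real.cos (ω * t))) →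
      (∀ t : ℝ, 0 ≤ t → Dc * t - K ≤ intervalIntegral (fun s : ℝ => (t - s) * C s) 0 t volume) →
      ∀ ν : ℝ, 0 < ν →
        Dc - K * ν ≤ MeasureTheory.integral (volume.restrict (Set.Ioi (0:ℝ)))
          (fun t : ℝ => Real.exp (-(ν * t)) * C t)) :
    ∀ ω₂ lam β γ : ℝ, 0 < ω₂ → 0 < lam → 0 < β → 0 < γ → ∀ T : ℝ, 0 < T →
      ∃ (μT : Measure ChainConfig) (D : InfiniteChainDynamics (pinnedChain ω₂ lam β γ)) (κ : ℝ),
        (pinnedChain ω₂ lam β γ).IsChainGibbsMeasure T μT ∧ D.PreservesMeasure μT ∧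
        (∀ t : ℝ, D.HasAbsConvergentCorrelation μT t) ∧ 0 < κ ∧
        Tendsto (fun ν : ℝ => (T ^ 2)⁻¹ * ∫ t in Ioi (0 : ℝ),
            Real.exp (-(ν * t)) * D.currentCorrelation μT t) (𝓝[>] (0 : ℝ)) (𝓝 κ) := by
  intro ω₂ lam β γ hω hl hβ hγ T hT
  -- the canonical representation (landed)
  obtain ⟨D, Z, σ, hG, hRev, hsc, hσfin, hσeven, hC⟩ := exists_canonical_representation hω hl hβ hγ hT
  haveI : IsFiniteMeasure σ := hσfin
  have hshift : ∀ x : ℤ, MeasurePreserving (fun σ : ChainConfig => fun i : ℤ => σ (i + x)) Z.μ Z.μ :=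
    fun x => Z.measurePreserving_shift x
  have hpres : D.PreservesMeasure Z.μ := Z.preservesMeasure
  have habs : ∀ t : ℝ, D.HasAbsConvergentCorrelation Z.μ t :=
    fun t => Z.hasAbsConvergentCorrelation (Z.integral_bondCurrent_eq_zero hRev) t
  -- S1a + S1b: the window and the continuous density of the atom-free part
  obtain ⟨δ, g, hδ, hLAP⟩ := h1a ω₂ lam β γ hω hl hβ hγ T hT Z.μ D hG hshift hpres habs σ hσfin hσeven hC
  obtain ⟨hcont, hnonneg, hdens⟩ := h1b (σ.restrict {0}ᶜ) inferInstance δ g hLAP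
  -- S2a + S2b: no atom at frequency 0, hence `σ|_{ω ≠ 0} = σ`
  have h0 : σ {0} = 0 :=
    measure_zero_eq_zero_of_stubs h2a Z hRev hsc (h2b ω₂ lam β γ hω hl hβ hγ T hT D Z hG hRev) σ hC
  have hσ0 : σ.restrict {0}ᶜ = σ :=
    Measure.restrict_eq_self_of_ae_mem (compl_mem_ae_iff.mpr h0)
  rw [hσ0] at hdens
  -- S3a + S3b: the Abelian floor `Dc - K ν ≤ ∫ e^{-νt} C_T`
  obtain ⟨Dc, K, hDc, hfloor⟩ := h3a ω₂ lam β γ hω hl hβ hγ T hT Z.μ D hG hshift hpres habs σ hσfin hC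
  have habel : ∀ ν : ℝ, 0 < ν → Dc - K * ν ≤
      MeasureTheory.integral (volume.restrict (Set.Ioi (0:ℝ)))
        (fun t : ℝ => Real.exp (-(ν * t)) * D.currentCorrelation Z.μ t) :=
    h3b σ (D.currentCorrelation Z.μ) Dc K hσfin hC hfloor
  -- the PROVED Poisson-kernel lemma (stmt-12598): the Abel means converge to `π g 0`
  have hlim := Summit.AtomisticToContinuum.FouriersLaw.Theorems.AbelOfSpectralDensity.latticeLandauDamping_abelOfSpectralDensity_proof
    σ (D.currentCorrelation Z.μ) δ g hσfin hδ hC hcont hnonneg hdens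
  -- `0 < Dc ≤ π g 0`
  have hlin : Tendsto (fun ν : ℝ => Dc - K * ν) (𝓝[>] (0:ℝ)) (𝓝 Dc) := by
    have h : Tendsto (fun ν : ℝ => Dc - K * ν) (𝓝 (0:ℝ)) (𝓝 (Dc - K * 0)) :=
      Continuous.tendsto (by fun_prop) 0
    simp only [mul_zero, sub_zero] at h
    exact h.mono_left nhdsWithin_le_nhds
  have hle : Dc ≤ Real.pi * g 0 := by
    refine le_of_tendsto_of_tendsto hlin hlim ?_
    filter_upwards [self_mem_nhdsWithin] with ν hν using habel ν hν
  have hπg : 0 < Real.pi * g 0 := lt_of_lt_of_le hDc hle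
  refine ⟨Z.μ, D, (T ^ 2)⁻¹ * (Real.pi * g 0), hG, hpres, habs, by positivity, ?_⟩
  exact hlim.const_mul ((T ^ 2)⁻¹)

/-- **`GreenKuboContinuation_of` — the registered skeleton.** The crux
`Summit.AtomisticToContinuum.FouriersLaw.Theses.EmbeddedDrudeMourre.GreenKuboContinuation` follows from
the six declared stubs BY NAME and nothing else: all-`T` Abelian witnesses (`abelWitnessAllT_of_stubs`)
imply the propagation-shaped crux with its corner hypothesis discarded
(`greenKuboContinuation_of_abelWitnessAllT`, p115442). Axiom closure
`{propext, Classical.choice, Quot.sound} ∪ {sorryAx via the open stubs}`. -/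
theorem GreenKuboContinuation_of :
    Summit.AtomisticToContinuum.FouriersLaw.Theses.EmbeddedDrudeMourre.GreenKuboContinuation :=
  greenKuboContinuation_of_abelWitnessAllT
    (abelWitnessAllT_of_stubs stub_zeroFrequencyLAP stub_stieltjesInversion stub_atomEqDrudeWeightOfContinuous
      stub_conservedClassesEven stub_einsteinHelfandFloor stub_abelFloorOfEinsteinHelfand)

/-! ## Coarse composition (the strategist's glue, kept for robustness)

If the three LatticeLandauDamping cruxes `WindowDecomposition` / `NoDrudeWeight` / `PositiveDensity`
(stmt-14011 / 14012 / 14014) are closed by ANY line — not necessarily through the birth stubs registered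
above — the crux still follows, by the landed glue `abelGreenKuboOfWindow_proof` (p87901) and the proved
Poisson-kernel lemma (stmt-12598).  Hypothesis form (no stubs registered by it); this is verbatim the
prepared split glue `GreenKuboContinuation_of_subs` (item evidence #103, children.json). -/

/-- **Coarse glue** `WindowDecomposition → NoDrudeWeight → PositiveDensity → GreenKuboContinuation`
(the three LatticeLandauDamping crux statements BY NAME; sorry-free, standard axioms). [folklore] -/
theorem greenKuboContinuation_of_trichotomy
    (h1 : Summit.AtomisticToContinuum.FouriersLaw.Theses.LatticeLandauDamping.WindowDecomposition)
    (h2 : Summit.AtomisticToContinuum.FouriersLaw.Theses.LatticeLandauDamping.NoDrudeWeight)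
    (h3 : Summit.AtomisticToContinuum.FouriersLaw.Theses.LatticeLandauDamping.PositiveDensity) :
    Summit.AtomisticToContinuum.FouriersLaw.Theses.EmbeddedDrudeMourre.GreenKuboContinuation :=
  greenKuboContinuation_of_abelWitnessAllT
    (Summit.AtomisticToContinuum.FouriersLaw.Theorems.abelGreenKuboOfWindow_proof h1 h2 h3
      Summit.AtomisticToContinuum.FouriersLaw.Theorems.AbelOfSpectralDensity.latticeLandauDamping_abelOfSpectralDensity_proof)

end Summit.AtomisticToContinuum.FouriersLaw.Theorems.GreenKuboContinuation.SpectralTrichotomy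

end
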